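import Literature.NumberTheory.GaloisRepresentations.ConjugationDescent
import Literature.AnabelianGeometry.AbsoluteAnabelian.FundamentalExtensionRestrictionMLFBaseConj
import Literature.NumberTheory.GaloisRepresentations.GaloisSubgroups
import HarnessLib

/-!
# Restriction to the subgroup `Gal(K̄/K′) ≤ Γ_K` versus restriction to the field `K′`: agreement on `H²` up to the
# canonical isomorphism (the absolute Galois group is defined up to an inner automorphism)

Topic `NumberTheory/GaloisRepresentations`; namespace `Literature.NumberTheory.GaloisRepresentations`.  Theorems only (two
private plumbing morphisms); no named fact, no instance, no `sorry`.  Sequel of `ConjugationDescent` (`map_eq_map_of_inner_two`: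
inner automorphisms act trivially on `H²`, relative form) and of the abc-iut cell's `FundamentalExtensionRestrictionMLFBaseConj`
(`exists_absGaloisRestrict_fixingSubgroupEquivAbsoluteGaloisGroup_eq_conj`: the tree's two identifications of `Gal(K̄/K′)` — the
subgroup `K′.fixingSubgroup ≤ Γ_K` and the restriction `absGaloisRestrict K K′ : Γ_{K′} → Γ_K` composed with
`fixingSubgroupEquivAbsoluteGaloisGroup K′ : K′.fixingSubgroup ≃ₜ* Γ_{K′}` — differ by conjugation by ONE `γ ∈ Γ_K`).

For a field `K : Type`, a subextension `K′ ⊆ K̄`, a discrete `Γ_K`-module `X` and a class `x ∈ H²(K, X)`: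
* `exists_map_resH_galFixing_eq_res` — **`Φ(res_{U′} x) = res_{K′} x`** where `U′ = galFixing K K′ = Gal(K̄/K′)`,
  `res_{U′} = resH U′ X 2` (restriction to the SUBGROUP), `res_{K′} = galoisCohomology.res X K′ 2` (restriction to the FIELD) and
  `Φ : H²(U′, X) → H²(K′, X|_{K′})` is the change of group along `e⁻¹ : Γ_{K′} ≃ U′` with coefficient map `v ↦ γ v`;
* **`resH_galFixing_eq_zero_of_res_eq_zero`** / `resH_absGaloisFixingSubgroup_eq_zero_of_res_eq_zero` — hence
  `res_{K′} x = 0 ⟹ res_{U′} x = 0` (`Φ` is injective: the change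
  of group along `e` with `v ↦ γ⁻¹ v` is a left inverse).

USE: the Poitou–Tate road of cell `bsd-wall` (seat `bsd-line-chl-p2`, K4 `RedSplitControlAtThree`): the input (A3) of
`HomDual.localGlobal_of_forall_evalPoint` is phrased on the subgroup `Γ_{K(M)} ≤ Γ_K` (inflation–restriction lives there),
while Brauer–Hasse–Noether (`shaTwo_units_eq_bot`) speaks of the number field `K(M)`; this file is the bridge.
HONEST FRAMING: Galois-theoretic bookkeeping; no arithmetic statement is proved here.

## References
* J.-P. Serre, *Local Fields* (1979), VII §5 Prop. 3 (inner automorphisms act trivially). [SerreLocalFields1979]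
* J. S. Milne, *Fields and Galois Theory* (2022), Ch. 7 (the absolute Galois group up to inner automorphism). [MilneFT2022]
* J. Neukirch, A. Schmidt, K. Wingberg, *Cohomology of Number Fields* (2008), (1.5.2), (1.6.2). [NeukirchSchmidtWingberg2008]
-/

noncomputable section

open CategoryTheory Field

namespace Literature.NumberTheory.GaloisRepresentations

open _root_.TopRep _root_.ContRepresentation _root_.ContinuousCohomology
open Literature.FieldTheory.Galois (fixingSubgroupEquivAbsoluteGaloisGroup)
open Literature.AnabelianGeometry.AbsoluteAnabelian (exists_absGaloisRestrict_fixingSubgroupEquivAbsoluteGaloisGroup_eq_conj)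

variable {K : Type} [Field K] (K' : IntermediateField K (AlgebraicClosure K))
variable {V : Type} [AddCommGroup V] [TopologicalSpace V] [DiscreteTopology V] (X : DiscreteGaloisModule K V)

open LocalWeilDatum (galFixing)

/-- `Gal(K̄/K′) ≃ₜ* Γ_{K′}` on the tree's spelling `galFixing K K′ ≤ Γ_K` of the fixing subgroup (the abc-iut cell's
`fixingSubgroupEquivAbsoluteGaloisGroup K′`, whose source `K′.fixingSubgroup` is the same subgroup). [cite: MilneFT2022, Ch. 7] -/
private def galFixingEquiv : galFixing K K' ≃ₜ* absoluteGaloisGroup K' :=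
  show K'.fixingSubgroup ≃ₜ* absoluteGaloisGroup K' from fixingSubgroupEquivAbsoluteGaloisGroup K'

/-- The conjugating element: `res_{K′/K} (e σ) = γ σ γ⁻¹` for all `σ ∈ Gal(K̄/K′)`. [cite: MilneFT2022, Ch. 7] -/
private theorem exists_conj :
    ∃ γ : absoluteGaloisGroup K, ∀ σ : galFixing K K',
      absGaloisRestrict K K' (galFixingEquiv K' σ) = γ * (σ : absoluteGaloisGroup K) * γ⁻¹ := by
  obtain ⟨γ, hγ⟩ := exists_absGaloisRestrict_fixingSubgroupEquivAbsoluteGaloisGroup_eq_conj K K'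
  exact ⟨γ, fun σ => hγ ⟨σ.1, σ.2⟩⟩

/-- `v ↦ γ v` along `e⁻¹ : Γ_{K′} → Gal(K̄/K′)`, from `X|_{Gal(K̄/K′)}` to `X|_{K′}` (equivariant because `res(e σ) = γ σ γ⁻¹`).
[folklore] -/
private def twistHom (γ : absoluteGaloisGroup K)
    (he : ∀ σ : galFixing K K', absGaloisRestrict K K' (galFixingEquiv K' σ) = γ * (σ : absoluteGaloisGroup K) * γ⁻¹) :
    TopRep.res (((galFixingEquiv K').symm : absoluteGaloisGroup K' →ₜ* galFixing K K') :
        absoluteGaloisGroup K' →* galFixing K K') (X.restrict (subgroupIncl (galFixing K K'))).toTopRep ⟶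
      (X.restrictField K').toTopRep :=
  TopRep.ofHom ⟨⟨X γ, continuous_of_discreteTopology⟩, fun τ => by
    refine ContinuousLinearMap.ext fun v => ?_
    obtain ⟨σ, rfl⟩ := (galFixingEquiv K').surjective τ
    change X γ (X ((galFixingEquiv K').symm (galFixingEquiv K' σ) : absoluteGaloisGroup K) v) =
      X (absGaloisRestrict K K' (galFixingEquiv K' σ)) (X γ v)
    rw [ContinuousMulEquiv.symm_apply_apply, he, ← Module.End.mul_apply, ← map_mul, ← Module.End.mul_apply, ← map_mul]
    exact congrArg (fun g => X g v) (by group)⟩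

/-- `v ↦ γ⁻¹ v` along `e : Gal(K̄/K′) → Γ_{K′}`, from `X|_{K′}` back to `X|_{Gal(K̄/K′)}`. [folklore] -/
private def untwistHom (γ : absoluteGaloisGroup K)
    (he : ∀ σ : galFixing K K', absGaloisRestrict K K' (galFixingEquiv K' σ) = γ * (σ : absoluteGaloisGroup K) * γ⁻¹) :
    TopRep.res ((galFixingEquiv K' : galFixing K K' →ₜ* absoluteGaloisGroup K') :
        galFixing K K' →* absoluteGaloisGroup K') (X.restrictField K').toTopRep ⟶
      (X.restrict (subgroupIncl (galFixing K K'))).toTopRep :=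
  TopRep.ofHom ⟨⟨X γ⁻¹, continuous_of_discreteTopology⟩, fun σ => by
    refine ContinuousLinearMap.ext fun v => ?_
    change X γ⁻¹ (X (absGaloisRestrict K K' (galFixingEquiv K' σ)) v) = X (σ : absoluteGaloisGroup K) (X γ⁻¹ v)
    rw [he, ← Module.End.mul_apply, ← map_mul, ← Module.End.mul_apply, ← map_mul]
    exact congrArg (fun g => X g v) (by group)⟩

/-- **Restriction to the subgroup `Gal(K̄/K′)` and restriction to the field `K′` agree on `H²` up to an isomorphism**:
there are `γ ∈ Γ_K`, a change of group `Φ = H²(e⁻¹, v ↦ γ v) : H²(Gal(K̄/K′), X) → H²(K′, X|_{K′})` and a left inverse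
`Ψ = H²(e, v ↦ γ⁻¹ v)` with `Φ(resH (galFixing K K′) X 2 x) = galoisCohomology.res X K′ 2 x` for every `x ∈ H²(K, X)` (inner
automorphisms act trivially on `H²`). [cite: SerreLocalFields1979, VII §5 Prop. 3][cite: MilneFT2022, Ch. 7]
[cite: NeukirchSchmidtWingberg2008, (1.5.2)] -/
theorem exists_map_resH_galFixing_eq_res :
    ∃ (Φ : continuousCohomology 2 (X.restrict (subgroupIncl (galFixing K K'))).toTopRep →+
        galoisCohomology (X.restrictField K') 2)
      (Ψ : galoisCohomology (X.restrictField K') 2 →+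
        continuousCohomology 2 (X.restrict (subgroupIncl (galFixing K K'))).toTopRep),
      (∀ y, Ψ (Φ y) = y) ∧ ∀ x : galoisCohomology X 2, Φ (resH (galFixing K K') X 2 x) = galoisCohomology.res X K' 2 x := by
  haveI := absoluteGaloisGroup_compactSpace K
  haveI := absoluteGaloisGroup_compactSpace K'
  haveI : CompactSpace (galFixing K K') :=
    isCompact_iff_compactSpace.mp (LocalWeilDatum.isClosed_galFixing K K').isCompact
  obtain ⟨γ, he⟩ := exists_conj K'
  set e := galFixingEquiv K' with he_def
  let Φ := (ContinuousCohomology.map (e.symm : absoluteGaloisGroup K' →ₜ* galFixing K K') (twistHom K' X γ he) 2).hom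
  let Ψ := (ContinuousCohomology.map (e : galFixing K K' →ₜ* absoluteGaloisGroup K') (untwistHom K' X γ he) 2).hom
  refine ⟨Φ.toLinearMap.toAddMonoidHom, Ψ.toLinearMap.toAddMonoidHom, fun y => ?_, fun x => ?_⟩
  · -- `Ψ ∘ Φ = H²(id, id) = id`
    change ContinuousCohomology.map (e : galFixing K K' →ₜ* absoluteGaloisGroup K') (untwistHom K' X γ he) 2
      (ContinuousCohomology.map (e.symm : absoluteGaloisGroup K' →ₜ* galFixing K K') (twistHom K' X γ he) 2 y) = y
    rw [← map_comp_apply_of (e.symm : absoluteGaloisGroup K' →ₜ* galFixing K K')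
      (e : galFixing K K' →ₜ* absoluteGaloisGroup K') (ContinuousMonoidHom.id _)
      (fun σ => (e.symm_apply_apply σ).symm) (twistHom K' X γ he) (untwistHom K' X γ he)
      (TopRep.ofHom ⟨ContinuousLinearMap.id ℤ V, fun _ => rfl⟩) (fun v => ?_) 2 y]
    · exact map_id_id_two _ y
    · change v = X γ⁻¹ (X γ v)
      rw [← Module.End.mul_apply, ← map_mul, inv_mul_cancel, map_one, Module.End.one_apply]
  · -- `Φ ∘ resH = H²(incl ∘ e⁻¹, γ) = H²(res, id)`
    change ContinuousCohomology.map (e.symm : absoluteGaloisGroup K' →ₜ* galFixing K K') (twistHom K' X γ he) 2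
      (resH (galFixing K K') X 2 x) = _
    let θ : absoluteGaloisGroup K' →ₜ* absoluteGaloisGroup K :=
      (subgroupIncl (galFixing K K')).comp (e.symm : absoluteGaloisGroup K' →ₜ* galFixing K K')
    have hθ : ∀ τ, θ τ = γ⁻¹ * absGaloisRestrict K K' τ * γ := by
      intro τ
      obtain ⟨σ, rfl⟩ := e.surjective τ
      change ((e.symm (e σ) : galFixing K K') : absoluteGaloisGroup K) = _
      rw [ContinuousMulEquiv.symm_apply_apply, he]
      group
    let f₁ : TopRep.res (θ : absoluteGaloisGroup K' →* absoluteGaloisGroup K) X.toTopRep ⟶ (X.restrictField K').toTopRep :=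
      TopRep.ofHom ⟨⟨X γ, continuous_of_discreteTopology⟩, fun τ => by
        refine ContinuousLinearMap.ext fun v => ?_
        change X γ (X (θ τ) v) = X (absGaloisRestrict K K' τ) (X γ v)
        rw [hθ, ← Module.End.mul_apply, ← map_mul, ← Module.End.mul_apply, ← map_mul]
        exact congrArg (fun g => X g v) (by group)⟩
    rw [← map_comp_apply_of (subgroupIncl (galFixing K K')) (e.symm : absoluteGaloisGroup K' →ₜ* galFixing K K') θ
      (fun _ => rfl) (𝟙 ((X.restrict (subgroupIncl (galFixing K K'))).toTopRep)) (twistHom K' X γ he) f₁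
      (fun _ => rfl) 2 x]
    exact map_eq_map_of_inner_two γ (absGaloisRestrict K K') θ hθ f₁
      (TopRep.ofHom ⟨ContinuousLinearMap.id ℤ V, fun _ => rfl⟩) (fun _ => rfl) x

/-- **`res_{K′} x = 0 ⟹ res_{Gal(K̄/K′)} x = 0` on `H²`**: restriction to the field `K′` and restriction to the subgroup
`galFixing K K′ = Gal(K̄/K′) ≤ Γ_K` have the same kernel (the comparison `Φ` is injective).
[cite: SerreLocalFields1979, VII §5 Prop. 3][cite: NeukirchSchmidtWingberg2008, (1.5.2)] -/
theorem resH_galFixing_eq_zero_of_res_eq_zero (x : galoisCohomology X 2) (hx : galoisCohomology.res X K' 2 x = 0) :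
    resH (galFixing K K') X 2 x = 0 := by
  obtain ⟨Φ, Ψ, hΨΦ, hΦ⟩ := exists_map_resH_galFixing_eq_res K' X
  rw [← hΨΦ (resH (galFixing K K') X 2 x), hΦ, hx, map_zero]

/-- The same for a NORMAL `K′`, on the spelling `absGaloisFixingSubgroup K′` of `Gal(K̄/K′)`.
[cite: SerreLocalFields1979, VII §5 Prop. 3][cite: NeukirchSchmidtWingberg2008, (1.5.2)] -/
theorem resH_absGaloisFixingSubgroup_eq_zero_of_res_eq_zero [Normal K K'] (x : galoisCohomology X 2)
    (hx : galoisCohomology.res X K' 2 x = 0) : resH (absGaloisFixingSubgroup K') X 2 x = 0 := by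
  rw [← galFixing_eq_absGaloisFixingSubgroup]
  exact resH_galFixing_eq_zero_of_res_eq_zero K' X x hx

end Literature.NumberTheory.GaloisRepresentations

end
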